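import Mathlib
import Summits.Ventures.PercRepro2.HCov
import Summits.Ventures.PercRepro2.HCovSwap
import Summits.Ventures.PercRepro2.RECMReduction
import Summits.Ventures.PercRepro2.GcTransport
import Summits.Ventures.PercRepro2.CutVertexPaths
import Summits.Ventures.PercRepro2.CutOneFar
import Summits.Ventures.PercRepro2.CutOneFarMarked
import Summits.Ventures.PercRepro2.PendantRootReduction
import Summits.Ventures.PercRepro2.LeafMarkReduction
import Summits.Ventures.PercRepro2.LeafMarkAny
import Summits.Ventures.PercRepro2.CutOneFarAny
import Summits.Ventures.PercRepro2.IsolatedMark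

/-!
# The cut-vertex reduction of (HCOV) for the marks `a₁, a₂, o, b` (blind cell PercRepro2, p5 g24;
`proofs/P5-OEDGE.md` §30 addendum 6)

`CutOneFarAny.lean` decides a mark `w ∈ {a₁, a₂, o, b}` alone behind a cut vertex `v`: outright when
`v` is a mark, and from (HCOV) on the right side with `w` moved to `v` when `v` is unmarked.  Here the
reductions are assembled into a strong induction on the number of non-loop edges ACROSS EDGE TYPES
(the reduced graph lives on `REdge side`): the reduced graph with its pendant edge turned into a loop
— by contraction (roots) or re-pointing (`o`, `b`) — has at most the right side's non-loop edges,
fewer than `G` whenever the left side has a non-loop edge (**`nonLoopCard_reduced_lt`**); when it has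
none, `w` is isolated and `Gc = 0` (`IsolatedMark`).

* the class **`NoMarkBehindCut`**: no cut vertex separates one of `a₁, a₂, o, b` alone from the other
  marks (a leaf is the special case `L = {w}`, so the class also excludes the leaves);
* **`HCovNC_all`** and **`HCov_all_of_noMarkBehindCut : HCovNC_all → HCov_all`**.

So a minimal counterexample to (HCOV) has no cut vertex separating one of `a₁, a₂, o, b` from the
others (hence each of them of degree ≥ 2); `a₃` alone behind an unmarked cut vertex remains the open
row (LEAF-½).
-/

namespace Summit.Ventures.PercRepro2

open CovForm CovForm.FirstOrder CutVertexM9 CutOneFar CutOneFarAny RECM LeafRoot LeafMark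
  LeafMarkAny IsolatedMark

namespace CutReduction

section Measure

variable {V : Type*} {E : Type*} [Fintype E] [DecidableEq E] [DecidableEq V]
variable {ends : E → Sym2 V} {side : E → Bool}

/-- **The measure drops**: a graph on the reduced edge type whose pendant edge is a loop and whose
right edges are loops whenever they are loops of `G` has fewer non-loop edges than `G`, as soon as
the left side of `G` has a non-loop edge. -/
lemma nonLoopCard_reduced_lt (ends' : REdge side → Sym2 V) (hpend : (ends' (Sum.inr ())).IsDiag)
    (hright : ∀ e : {e : E // side e = false}, (ends e.1).IsDiag → (ends' (Sum.inl e)).IsDiag)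
    {e₀ : E} (h₀ : side e₀ = true) (hd₀ : ¬ (ends e₀).IsDiag) :
    nonLoopCard ends' < nonLoopCard ends := by
  classical
  unfold nonLoopCard
  set S₁ := Finset.univ.filter fun f : REdge side => ¬ (ends' f).IsDiag with hS₁
  set S₂ := Finset.univ.filter fun e : E => ¬ (ends e).IsDiag with hS₂
  have he₀ : e₀ ∈ S₂ := by simp [hS₂, hd₀]
  -- the projection of the right edges
  let g : REdge side → E := fun f => match f with
    | Sum.inl e => e.1
    | Sum.inr _ => e₀
  have hmaps : ∀ f ∈ S₁, g f ∈ S₂.erase e₀ := by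
    rintro (e | u) hf
    · simp only [hS₁, Finset.mem_filter, Finset.mem_univ, true_and] at hf
      have hne : e.1 ≠ e₀ := by
        intro h
        have := e.2
        rw [h, h₀] at this
        exact Bool.false_ne_true this.symm
      simp only [Finset.mem_erase, hS₂, Finset.mem_filter, Finset.mem_univ, true_and]
      exact ⟨hne, fun hd => hf (hright e hd)⟩
    · exfalso
      simp only [hS₁, Finset.mem_filter, Finset.mem_univ, true_and] at hf
      exact hf hpend
  have hinj : Set.InjOn g S₁ := by
    rintro (e | ⟨⟩) he (e' | ⟨⟩) he' hg
    · exact congrArg Sum.inl (Subtype.ext hg)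
    · exfalso
      simp only [Finset.mem_coe, hS₁, Finset.mem_filter, Finset.mem_univ, true_and] at he'
      exact he' hpend
    · exfalso
      simp only [Finset.mem_coe, hS₁, Finset.mem_filter, Finset.mem_univ, true_and] at he
      exact he hpend
    · rfl
  calc S₁.card ≤ (S₂.erase e₀).card := Finset.card_le_card_of_injOn g hmaps hinj
    _ < S₂.card := Finset.card_erase_lt_of_mem he₀

variable {L : Set V} {v : V} {Rt : Set V} {w : V}

/-- The contracted reduced graph (a root `w`) has fewer non-loop edges than `G`, given a non-loop left
edge. -/
lemma nonLoopCard_contract_reduced_lt (v w : V) {e₀ : E} (h₀ : side e₀ = true)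
    (hd₀ : ¬ (ends e₀).IsDiag) :
    nonLoopCard (contractRootEdge (rends ends side v w) w v) < nonLoopCard ends :=
  nonLoopCard_reduced_lt (side := side) _ (isDiag_contractRootEdge (rends_pendant ends side v w))
    (fun _ hd => isDiag_contract_of_isDiag _ _ _ hd) h₀ hd₀

/-- The loop-re-pointed reduced graph (`o` or `b`) has fewer non-loop edges than `G`, given a non-loop
left edge. -/
lemma nonLoopCard_update_reduced_lt {e₀ : E} (h₀ : side e₀ = true) (hd₀ : ¬ (ends e₀).IsDiag)
    (v w : V) :
    nonLoopCard (Function.update (rends ends side v w) (Sum.inr ()) s(w, w)) < nonLoopCard ends :=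
  nonLoopCard_reduced_lt (side := side) _ (by rw [Function.update_self]; exact Sym2.mk_isDiag_iff.mpr rfl)
    (fun e hd => by
      rw [Function.update_of_ne (by simp : (Sum.inl e : REdge side) ≠ Sum.inr ())]
      exact hd) h₀ hd₀

omit [Fintype E] [DecidableEq E] [DecidableEq V] in
/-- If every left edge is a loop, the far mark is isolated. -/
lemma isolated_of_no_left_edge (h : CutVertex ends side L v Rt) (hw : w ∈ L)
    (hno : ∀ e, side e = true → (ends e).IsDiag) : IsIsolated ends w := by
  intro e he
  by_cases hs : side e = true
  · exact hno e hs
  · exfalso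
    have hs' : side e = false := by simpa using hs
    rcases h.right e hs' w he with hR | hv
    · exact h.disj w hw hR
    · exact h.vL (hv ▸ hw)

end Measure

section Classes

variable {V : Type*} {E : Type*}

/-- **The class `NoMarkBehindCut`**: no cut vertex `v` separates one of `a₁, a₂, o, b` alone from the
other marks (the other marks on the right side or at `v`). -/
def NoMarkBehindCut (ends : E → Sym2 V) (o a₁ a₂ a₃ b : V) : Prop :=
  ¬ ∃ (side : E → Bool) (L Rt : Set V) (v w : V), CutVertex ends side L v Rt ∧ w ∈ L ∧
    (w = a₁ ∨ w = a₂ ∨ w = o ∨ w = b) ∧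
    ∀ m ∈ ({o, a₁, a₂, a₃, b} : Set V), m = w ∨ m ∈ Rt ∨ m = v

end Classes

section Closure

variable (R : Type*) [Field R] [LinearOrder R] [IsStrictOrderedRing R]

/-- **(HCOV) on the class `NoMarkBehindCut`**. -/
def HCovNC_all : Prop :=
  ∀ (V E : Type) [Fintype V] [DecidableEq V] [Fintype E] [DecidableEq E]
    (ends : E → Sym2 V) (p : E → R), IsProbVec p →
    ∀ o a₁ a₂ a₃ b : V, a₁ ≠ a₂ → a₁ ≠ a₃ → a₂ ≠ a₃ → o ≠ a₁ → o ≠ a₂ → o ≠ a₃ → o ≠ b →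
      b ≠ a₁ → b ≠ a₂ → b ≠ a₃ → NoMarkBehindCut ends o a₁ a₂ a₃ b → HCov p ends o a₁ a₂ a₃ b

end Closure

section Main

variable {R : Type*} [Field R] [LinearOrder R] [IsStrictOrderedRing R]

/-- **The cut-vertex reduction, by strong induction on the number of non-loop edges across edge
types**. -/
theorem HCov_of_noMarkBehindCut (hB : HCovNC_all R) (n : ℕ) :
    ∀ (V E : Type) [Fintype V] [DecidableEq V] [Fintype E] [DecidableEq E]
      (ends : E → Sym2 V), nonLoopCard ends = n → ∀ (p : E → R), IsProbVec p →
      ∀ o a₁ a₂ a₃ b : V, a₁ ≠ a₂ → a₁ ≠ a₃ → a₂ ≠ a₃ → o ≠ a₁ → o ≠ a₂ → o ≠ a₃ → o ≠ b →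
        b ≠ a₁ → b ≠ a₂ → b ≠ a₃ → HCov p ends o a₁ a₂ a₃ b := by
  induction n using Nat.strong_induction_on with
  | _ n ih =>
  intro V E _ _ _ _ ends hn p hp o a₁ a₂ a₃ b h12 h13 h23 ho1 ho2 ho3 hob hb1 hb2 hb3
  by_cases hcut : ∃ (side : E → Bool) (L Rt : Set V) (v w : V), CutVertex ends side L v Rt ∧ w ∈ L ∧
      (w = a₁ ∨ w = a₂ ∨ w = o ∨ w = b) ∧
      ∀ m ∈ ({o, a₁, a₂, a₃, b} : Set V), m = w ∨ m ∈ Rt ∨ m = v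
  · obtain ⟨side, L, Rt, v, w, h, hw, hwm, hM⟩ := hcut
    rcases mark_or_unmarked o a₁ a₂ a₃ b v with hv | hv
    · -- the cut vertex is a mark: (HCOV) outright
      exact HCov_mark_behind_mark h hp hw hwm hv hM h12 h13 h23 ho1 ho2 ho3 hob hb1 hb2 hb3
    · -- the cut vertex is unmarked: every mark other than `w` is on the right
      have hRt : ∀ m ∈ ({o, a₁, a₂, a₃, b} : Set V), m ≠ w → m ∈ Rt := by
        intro m hm hmw
        rcases hM m hm with h' | h' | h'
        · exact absurd h' hmw
        · exact h'
        · exfalso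
          obtain ⟨hvo, hv1, hv2, hv3, hvb⟩ := hv
          simp only [Set.mem_insert_iff, Set.mem_singleton_iff] at hm
          rcases hm with rfl | rfl | rfl | rfl | rfl
          · exact hvo h'.symm
          · exact hv1 h'.symm
          · exact hv2 h'.symm
          · exact hv3 h'.symm
          · exact hvb h'.symm
      by_cases hleft : ∃ e, side e = true ∧ ¬ (ends e).IsDiag
      · obtain ⟨e₀, h₀, hd₀⟩ := hleft
        have hp' := isProbVec_rweights_leftProb ends side v w hp
        rcases hwm with rfl | rfl | rfl | rfl
        · -- `a₁` behind `v`
          have hIH := ih _ (hn ▸ nonLoopCard_contract_reduced_lt v w h₀ hd₀) V (REdge side)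
            (contractRootEdge (rends ends side v w) w v) rfl _ hp' o w a₂ a₃ b h12 h13 h23 ho1 ho2
            ho3 hob hb1 hb2 hb3
          exact HCov_a1_behind_unmarked h hp hw (hRt o (by simp) ho1) (hRt a₂ (by simp) h12.symm)
            (hRt a₃ (by simp) h13.symm) (hRt b (by simp) hb1) hIH
        · -- `a₂` behind `v`
          have hIH := ih _ (hn ▸ nonLoopCard_contract_reduced_lt v w h₀ hd₀) V (REdge side)
            (contractRootEdge (rends ends side v w) w v) rfl _ hp' o a₁ w a₃ b h12 h13 h23 ho1 ho2
            ho3 hob hb1 hb2 hb3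
          exact HCov_a2_behind_unmarked h hp hw (hRt o (by simp) ho2) (hRt a₁ (by simp) h12)
            (hRt a₃ (by simp) h23.symm) (hRt b (by simp) hb2) hIH
        · -- `o` behind `v`: the mark moves to `v`
          obtain ⟨hvo, hv1, hv2, hv3, hvb⟩ := hv
          have hIH := ih _ (hn ▸ nonLoopCard_update_reduced_lt h₀ hd₀ v w) V (REdge side)
            (Function.update (rends ends side v w) (Sum.inr ()) s(w, w)) rfl _ hp' v a₁ a₂ a₃ b
            h12 h13 h23 hv1 hv2 hv3 hvb hb1 hb2 hb3
          exact HCov_o_behind_unmarked h hp hw (hRt a₁ (by simp) ho1.symm) (hRt a₂ (by simp) ho2.symm)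
            (hRt a₃ (by simp) ho3.symm) (hRt b (by simp) hob.symm) hIH
        · -- `b` behind `v`
          obtain ⟨hvo, hv1, hv2, hv3, hvb⟩ := hv
          have hIH := ih _ (hn ▸ nonLoopCard_update_reduced_lt h₀ hd₀ v w) V (REdge side)
            (Function.update (rends ends side v w) (Sum.inr ()) s(w, w)) rfl _ hp' o a₁ a₂ a₃ v
            h12 h13 h23 ho1 ho2 ho3 hvo.symm hv1 hv2 hv3
          exact HCov_b_behind_unmarked h hp hw (hRt o (by simp) hob) (hRt a₁ (by simp) hb1.symm)
            (hRt a₂ (by simp) hb2.symm) (hRt a₃ (by simp) hb3.symm) hIH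
      · -- no non-loop left edge: `w` is isolated
        push Not at hleft
        have hiso : IsIsolated ends w := isolated_of_no_left_edge h hw fun e he => hleft e he
        apply HCov_isolated_mark p h12 h13 h23 ho1 ho2 hb1 hb2
        rcases hwm with rfl | rfl | rfl | rfl
        · exact Or.inl hiso
        · exact Or.inr (Or.inl hiso)
        · exact Or.inr (Or.inr (Or.inl hiso))
        · exact Or.inr (Or.inr (Or.inr hiso))
  · exact hB V E ends p hp o a₁ a₂ a₃ b h12 h13 h23 ho1 ho2 ho3 hob hb1 hb2 hb3 hcut

/-- **THE CUT-VERTEX REDUCTION OF (HCOV) FOR `a₁, a₂, o, b`**: `HCovNC_all → HCov_all` — (HCOV) for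
every finite weighted graph follows from (HCOV) on the graphs in which no cut vertex separates one of
`a₁, a₂, o, b` alone from the other marks. -/
theorem HCov_all_of_noMarkBehindCut (hB : HCovNC_all R) : HCov_all R := by
  intro V E _ _ _ _ ends p hp o a₁ a₂ a₃ b h12 h13 h23 ho1 ho2 ho3 hob hb1 hb2 hb3
  exact HCov_of_noMarkBehindCut hB _ V E ends rfl p hp o a₁ a₂ a₃ b h12 h13 h23 ho1 ho2 ho3 hob hb1
    hb2 hb3

end Main

end CutReduction

end Summit.Ventures.PercRepro2
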